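import Mathlib
import HarnessLib
import Summits.HubbardSuperconductivity.HubbardSuperconductivity.Theorems.KLProgrammeKLRegimeEnginePairLadderV8

/-!
# Route `KLProgramme` — crux K3, ENGINE child gen 4 (stmt-HubbardSuperconductivity-19855 `KLRegimeEngineV12`), clause (E2-v8) at `1 ≤ n`:
# the ONE-SLICE BETHE–SALPETER form of the core inequality, and the exact INCREMENT IDENTITY of the resummation through cumulative rungs

Cell gate-hubbard-kl, seat hubbard-kl-k3c1-p1 (g4), technique «composed-map remainder propagation».  The (E2) bridge of this seat
(`pairLadderStepAtV8_of_expansion{,_unif,_unif'}`, p471830/p473679/p474511) leaves the engine ONE inequality per pair class (input 8 of the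
interface note): `‖𝒞_n(Qm;k,k′) − T_K((k,a₀),(k′,a₀))‖ + [four-term localisation of K − 𝒞̂_{n−1}] ≤ drivePBar + eremBar + thermalBar +
legDressBarQ·countT`, `T_K = Σ_j K(−diag z′·K)^j` the one-slice ladder with the engine's rung `K` and step weights `z′` on `TorusSite 2 L × F`.
This file propagates the remainder one level further, by exact matrix algebra only:

§1 (generic finite carrier, right-inverse hypotheses only — no `⁻¹`, no smallness): the push-through inverse `klli_pushThrough_inv`
(`(1 + D·I)·M = 1 ⇒ 1 − I·M·D` inverts `1 + I·D`), the COMPOSITION LAW in right-inverse form `klli_compose` (resumming with `D_B` then with `D_w`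
is resumming with `D_B + D_w`: the algebra behind «the step-`n` rung weight is the FULL increment `B_n − B_{n−1}` of the cumulative bubble», p1 g7
HOME/STATUS 00:11:57Z), the resolvent difference `klli_resolvent_sub` (`I′M′ − I·M̃ = (1 − I′M′·D)·(I′ − I)·M̃`), and their assembly
**`klli_increment_identity`**: with `C = I·M` resummed at cumulative weights `D_B`, `C·N` its one-step resummation at the increment `D_w`, and
`C′ = I′·M′` resummed at `D_B + D_w`,
`C′ − C·N = (1 − C′·(D_B + D_w)) · (I′ − I) · (1 − (D_B + D_w)·(C·N))` —
the per-scale (E2) remainder IS the increment `I′ − I` of the irreducible kernel dressed by the two cumulative resolvents (diagonal form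
`klli_increment_identity_diag`).  §2: the entrywise four-term bound of such a sandwich `klli_sandwich_entry_le` and its row/column-mass form
`klli_sandwich_entry_le_of_rowcol` (`≤ η·(1 + ρ_x)·(1 + τ_y)`, `ρ_x = Σ_a ‖C′(x,a)‖‖d_a‖`, `τ_y = Σ_b ‖d_b‖‖(C·N)(b,y)‖` — for the true arrays
these are the RESUMMED products `u·W ≤ 1`, not the crude `2|U|·bhi·n`).  §3 (model, by name on BundleV12): **`pairLadderStepAtV8_of_sliceBS`** —
taking `K := J`, the one-slice pair-irreducible rung, in `pairLadderStepAtV8_of_expansion` makes `‖𝒞_n − T_K‖` vanish, so (E2-v8) at `1 ≤ n`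
follows from: the Bethe–Salpeter identity `𝒞_n(Qm;k,k′) = (J·N)((k,a₀),(k′,a₀))` with `(1 + diag z′·J)·N = 1`, the rung/mass/(neg)/(real)
inputs as before, and ONE number `η` with `‖J(a,b) − 𝒞̂_{n−1}(Qm;a.1,b.1)‖ ≤ η` on relevant-or-external index pairs and `(9/4)·η ≤` the V7
budget (`klli_fourTerm_le_of_sup`: the four-term expression collapses to `(1 + ½ + ½ + ¼)·η`).  Arithmetic/algebra only; nothing about the
model is asserted.  0 kit.
-/

noncomputable section

namespace Summit.HubbardSuperconductivity.HubbardSuperconductivity.Theorems.KLRegimeSplit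

set_option linter.dupNamespace false -- summit = problem name (single-conjunct summit), D-0017

open Finset Matrix Literature.MathematicalPhysics.QuantumLattice Literature.Probability.LatticeModels
open Summit.HubbardSuperconductivity.HubbardSuperconductivity.Theorems.KLProgrammeCooperResummation
open Summit.HubbardSuperconductivity.HubbardSuperconductivity.Theorems.KLProgrammeLegKernels

/-! ## §1 Exact right-inverse algebra of the resummation `F_D(I) = I·M`, `(1 + D·I)·M = 1` -/

section Algebra

variable {ι : Type*} [Fintype ι] [DecidableEq ι]

/-- **Push-through inverse.**  From a right inverse `M` of `1 + D·I`, the matrix `1 − I·M·D` is a two-sided inverse of `1 + I·D`. -/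
theorem klli_pushThrough_inv (I D M : Matrix ι ι ℂ) (hM : (1 + D * I) * M = 1) :
    (1 + I * D) * (1 - I * M * D) = 1 ∧ (1 - I * M * D) * (1 + I * D) = 1 := by
  have hM' : M * (1 + D * I) = 1 := mul_eq_one_comm.mp hM
  constructor
  · calc (1 + I * D) * (1 - I * M * D) = 1 + I * D - I * ((1 + D * I) * M) * D := by noncomm_ring
      _ = 1 := by rw [hM]; noncomm_ring
  · calc (1 - I * M * D) * (1 + I * D) = 1 + I * D - I * (M * (1 + D * I)) * D := by noncomm_ring
      _ = 1 := by rw [hM']; noncomm_ring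

/-- **Push-through.**  `I·M = (1 − I·M·D)·I`: the resummed array is the kernel dressed by the (left) resolvent. -/
theorem klli_pushThrough (I D M : Matrix ι ι ℂ) (hM : (1 + D * I) * M = 1) : I * M = (1 - I * M * D) * I := by
  have hM' : M * (1 + D * I) = 1 := mul_eq_one_comm.mp hM
  symm
  calc (1 - I * M * D) * I = I - I * (M * (1 + D * I)) + I * M := by noncomm_ring
    _ = I * M := by rw [hM']; noncomm_ring

/-- A right inverse of `1 + D·I` expands as `M = 1 − D·(I·M)`. -/
theorem klli_rightInv_expand (I D M : Matrix ι ι ℂ) (hM : (1 + D * I) * M = 1) : M = 1 - D * (I * M) := by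
  have h : M + D * I * M = 1 := by rw [add_mul, one_mul] at hM; exact hM
  calc M = (M + D * I * M) - D * (I * M) := by noncomm_ring
    _ = 1 - D * (I * M) := by rw [h]

/-- **Composition law in right-inverse form** (the algebra of `klcrf_compose` without units): if `M` right-inverts `1 + D_B·I` and `N`
right-inverts `1 + D_w·(I·M)`, then `M·N` right-inverts `1 + (D_B + D_w)·I` — resumming the cumulative rungs `D_B` and then the increment `D_w`
is resumming `D_B + D_w` at once, and `F_{D_w}(F_{D_B}(I)) = (I·M)·N = I·(M·N) = F_{D_B + D_w}(I)`. -/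
theorem klli_compose (I DB Dw M N : Matrix ι ι ℂ) (hM : (1 + DB * I) * M = 1) (hN : (1 + Dw * (I * M)) * N = 1) :
    (1 + (DB + Dw) * I) * (M * N) = 1 := by
  calc (1 + (DB + Dw) * I) * (M * N) = ((1 + DB * I) * M + Dw * (I * M)) * N := by noncomm_ring
    _ = (1 + Dw * (I * M)) * N := by rw [hM]
    _ = 1 := hN

/-- **Resolvent difference.**  With `M′` right-inverting `1 + D·I′` and `M̃` right-inverting `1 + D·I` (the SAME rungs `D`):
`I′·M′ − I·M̃ = (1 − I′·M′·D)·(I′ − I)·M̃`. -/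
theorem klli_resolvent_sub (I I' D M' Mt : Matrix ι ι ℂ) (hM' : (1 + D * I') * M' = 1) (hMt : (1 + D * I) * Mt = 1) :
    I' * M' - I * Mt = (1 - I' * M' * D) * (I' - I) * Mt := by
  have hM'c : M' * (1 + D * I') = 1 := mul_eq_one_comm.mp hM'
  have h1 : Mt - M' * D * I' * Mt + M' * D * I * Mt = M' := by
    have e1 : Mt - M' * D * I' * Mt = M' * Mt := by
      calc Mt - M' * D * I' * Mt = (1 - M' * D * I') * Mt := by noncomm_ring
        _ = (M' * (1 + D * I') - M' * D * I') * Mt := by rw [hM'c]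
        _ = M' * Mt := by noncomm_ring
    rw [e1]
    calc M' * Mt + M' * D * I * Mt = M' * ((1 + D * I) * Mt) := by noncomm_ring
      _ = M' := by rw [hMt, mul_one]
  symm
  calc (1 - I' * M' * D) * (I' - I) * Mt = I' * (Mt - M' * D * I' * Mt + M' * D * I * Mt) - I * Mt := by noncomm_ring
    _ = I' * M' - I * Mt := by rw [h1]

/-- **The increment identity of the resummation through cumulative rungs (exact).**  `I`, `I′` two kernels (old / new irreducible rungs), `D_B`
the cumulative rungs, `D_w` the increment; `M` right-inverts `1 + D_B·I` (so `C := I·M` is the old resummed array), `N` right-inverts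
`1 + D_w·C` (so `C·N` is its one-step resummation), `M′` right-inverts `1 + (D_B + D_w)·I′` (so `C′ := I′·M′` is the new resummed array).  Then
`C′ − C·N = (1 − C′·(D_B + D_w)) · (I′ − I) · (1 − (D_B + D_w)·(C·N))`. -/
theorem klli_increment_identity (I I' DB Dw M N M' : Matrix ι ι ℂ) (hM : (1 + DB * I) * M = 1) (hN : (1 + Dw * (I * M)) * N = 1)
    (hM' : (1 + (DB + Dw) * I') * M' = 1) :
    I' * M' - I * M * N = (1 - I' * M' * (DB + Dw)) * (I' - I) * (1 - (DB + Dw) * (I * M * N)) := by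
  have hMt : (1 + (DB + Dw) * I) * (M * N) = 1 := klli_compose I DB Dw M N hM hN
  have h := klli_resolvent_sub I I' (DB + Dw) M' (M * N) hM' hMt
  have hexp := klli_rightInv_expand I (DB + Dw) (M * N) hMt
  rw [mul_assoc I M N, h, ← mul_assoc I M N]
  congr 1
  rw [mul_assoc I M N]
  exact hexp

/-- The increment identity with DIAGONAL weights: cumulative `B`, increment `w`, new cumulative `B + w`. -/
theorem klli_increment_identity_diag (I I' M N M' : Matrix ι ι ℂ) (B w : ι → ℂ) (hM : (1 + diagonal B * I) * M = 1)
    (hN : (1 + diagonal w * (I * M)) * N = 1) (hM' : (1 + diagonal (B + w) * I') * M' = 1) :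
    I' * M' - I * M * N = (1 - I' * M' * diagonal (B + w)) * (I' - I) * (1 - diagonal (B + w) * (I * M * N)) := by
  have hd : diagonal (B + w) = diagonal B + diagonal w := (diagonal_add B w).symm
  rw [hd] at hM' ⊢
  exact klli_increment_identity I I' (diagonal B) (diagonal w) M N M' hM hN hM'

/-- The SMALL-weight case of the same algebra (one slice, no cumulative rungs: `B = 0`): with `N` right-inverting `1 + D_w·I` and `M′`
right-inverting `1 + D_w·I′`, `I′·M′ − I·N = (1 − I′·M′·D_w)·(I′ − I)·(1 − D_w·(I·N))` — the identity behind `klell_kernel_perturbation`. -/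
theorem klli_slice_identity (I I' Dw N M' : Matrix ι ι ℂ) (hN : (1 + Dw * I) * N = 1) (hM' : (1 + Dw * I') * M' = 1) :
    I' * M' - I * N = (1 - I' * M' * Dw) * (I' - I) * (1 - Dw * (I * N)) := by
  have h := klli_resolvent_sub I I' Dw M' N hM' hN
  rw [h, ← klli_rightInv_expand I Dw N hN]

end Algebra

/-! ## §2 Entrywise bounds of a resolvent sandwich `(1 − C′·diag d)·δ·(1 − diag d·T)` -/

section Bounds

variable {ι : Type*} [Fintype ι] [DecidableEq ι]

/-- Entries of `A·diag d·B`: `(A·diag d·B)(x,y) = Σ_b A(x,b)·d_b·B(b,y)`. -/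
theorem klli_mul_diag_mul_apply (A B : Matrix ι ι ℂ) (d : ι → ℂ) (x y : ι) :
    (A * diagonal d * B) x y = ∑ b, A x b * d b * B b y := by
  rw [Matrix.mul_apply]
  refine sum_congr rfl fun b _ => ?_
  rw [Matrix.mul_diagonal]

/-- **Four-term expansion of the sandwich (exact).**
`(1 − C′·D)·δ·(1 − D·T) = δ − δ·D·T − C′·D·δ + C′·D·δ·D·T` (`D = diag d`). -/
theorem klli_sandwich_expand (C' δ T D : Matrix ι ι ℂ) :
    (1 - C' * D) * δ * (1 - D * T) = δ - δ * D * T - C' * D * δ + C' * D * δ * D * T := by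
  noncomm_ring

/-- **Entrywise four-term bound of the sandwich.**  For all `x y`:
`‖((1 − C′·diag d)·δ·(1 − diag d·T))(x,y)‖ ≤ ‖δ(x,y)‖ + Σ_b ‖δ(x,b)‖‖d_b‖‖T(b,y)‖ + Σ_a ‖C′(x,a)‖‖d_a‖‖δ(a,y)‖ +
Σ_a Σ_b ‖C′(x,a)‖‖d_a‖‖δ(a,b)‖‖d_b‖‖T(b,y)‖`. -/
theorem klli_sandwich_entry_le (C' δ T : Matrix ι ι ℂ) (d : ι → ℂ) (x y : ι) :
    ‖((1 - C' * diagonal d) * δ * (1 - diagonal d * T)) x y‖ ≤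
      ‖δ x y‖ + ∑ b, ‖δ x b‖ * ‖d b‖ * ‖T b y‖ + ∑ a, ‖C' x a‖ * ‖d a‖ * ‖δ a y‖ +
        ∑ a, ∑ b, ‖C' x a‖ * ‖d a‖ * ‖δ a b‖ * ‖d b‖ * ‖T b y‖ := by
  rw [klli_sandwich_expand, Matrix.add_apply, Matrix.sub_apply, Matrix.sub_apply]
  have h2 : ‖(δ * diagonal d * T) x y‖ ≤ ∑ b, ‖δ x b‖ * ‖d b‖ * ‖T b y‖ := by
    rw [klli_mul_diag_mul_apply]
    refine (norm_sum_le _ _).trans (le_of_eq (sum_congr rfl fun b _ => ?_))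
    rw [norm_mul, norm_mul]
  have h3 : ‖(C' * diagonal d * δ) x y‖ ≤ ∑ a, ‖C' x a‖ * ‖d a‖ * ‖δ a y‖ := by
    rw [klli_mul_diag_mul_apply]
    refine (norm_sum_le _ _).trans (le_of_eq (sum_congr rfl fun a _ => ?_))
    rw [norm_mul, norm_mul]
  have h4 : ‖(C' * diagonal d * δ * diagonal d * T) x y‖ ≤ ∑ a, ∑ b, ‖C' x a‖ * ‖d a‖ * ‖δ a b‖ * ‖d b‖ * ‖T b y‖ := by
    rw [klli_mul_diag_mul_apply]
    calc ‖∑ b, (C' * diagonal d * δ) x b * d b * T b y‖ ≤ ∑ b, ‖(C' * diagonal d * δ) x b * d b * T b y‖ := norm_sum_le _ _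
      _ = ∑ b, ‖(C' * diagonal d * δ) x b‖ * ‖d b‖ * ‖T b y‖ := sum_congr rfl fun b _ => by rw [norm_mul, norm_mul]
      _ ≤ ∑ b, (∑ a, ‖C' x a‖ * ‖d a‖ * ‖δ a b‖) * ‖d b‖ * ‖T b y‖ := by
          refine sum_le_sum fun b _ => ?_
          have hb : ‖(C' * diagonal d * δ) x b‖ ≤ ∑ a, ‖C' x a‖ * ‖d a‖ * ‖δ a b‖ := by
            rw [klli_mul_diag_mul_apply]
            refine (norm_sum_le _ _).trans (le_of_eq (sum_congr rfl fun a _ => ?_))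
            rw [norm_mul, norm_mul]
          exact mul_le_mul_of_nonneg_right (mul_le_mul_of_nonneg_right hb (norm_nonneg _)) (norm_nonneg _)
      _ = ∑ a, ∑ b, ‖C' x a‖ * ‖d a‖ * ‖δ a b‖ * ‖d b‖ * ‖T b y‖ := by
          rw [sum_comm]
          refine sum_congr rfl fun b _ => ?_
          rw [sum_mul, sum_mul]
  calc ‖δ x y - (δ * diagonal d * T) x y - (C' * diagonal d * δ) x y + (C' * diagonal d * δ * diagonal d * T) x y‖
      ≤ ‖δ x y - (δ * diagonal d * T) x y - (C' * diagonal d * δ) x y‖ + ‖(C' * diagonal d * δ * diagonal d * T) x y‖ := norm_add_le _ _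
    _ ≤ ‖δ x y - (δ * diagonal d * T) x y‖ + ‖(C' * diagonal d * δ) x y‖ + ‖(C' * diagonal d * δ * diagonal d * T) x y‖ := by
        gcongr; exact norm_sub_le _ _
    _ ≤ ‖δ x y‖ + ‖(δ * diagonal d * T) x y‖ + ‖(C' * diagonal d * δ) x y‖ + ‖(C' * diagonal d * δ * diagonal d * T) x y‖ := by
        gcongr; exact norm_sub_le _ _
    _ ≤ _ := by linarith

/-- **Row/column-mass form.**  If `‖δ‖ ≤ η` entrywise, the row mass of the new array against the rungs at `x` is `Σ_a ‖C′(x,a)‖‖d_a‖ ≤ ρ` and the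
column mass of the old one-step array at `y` is `Σ_b ‖d_b‖‖T(b,y)‖ ≤ τ`, then `‖((1 − C′·diag d)·δ·(1 − diag d·T))(x,y)‖ ≤ η·(1 + ρ)·(1 + τ)`.
(For the true pair arrays `ρ, τ` are the RESUMMED products `u·W ≤ 1` of the running s-wave value with the cumulative bubble mass.) -/
theorem klli_sandwich_entry_le_of_rowcol (C' δ T : Matrix ι ι ℂ) (d : ι → ℂ) {η ρ τ : ℝ} (hη : ∀ a b, ‖δ a b‖ ≤ η)
    (x y : ι) (hρ : ∑ a, ‖C' x a‖ * ‖d a‖ ≤ ρ) (hτ : ∑ b, ‖d b‖ * ‖T b y‖ ≤ τ) :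
    ‖((1 - C' * diagonal d) * δ * (1 - diagonal d * T)) x y‖ ≤ η * (1 + ρ) * (1 + τ) := by
  have hη0 : 0 ≤ η := (norm_nonneg _).trans (hη x y)
  have hρ0 : 0 ≤ ρ := le_trans (sum_nonneg fun a _ => mul_nonneg (norm_nonneg _) (norm_nonneg _)) hρ
  have hτ0 : 0 ≤ τ := le_trans (sum_nonneg fun b _ => mul_nonneg (norm_nonneg _) (norm_nonneg _)) hτ
  refine (klli_sandwich_entry_le C' δ T d x y).trans ?_
  have h1 : ‖δ x y‖ ≤ η := hη x y
  have h2 : ∑ b, ‖δ x b‖ * ‖d b‖ * ‖T b y‖ ≤ η * τ := by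
    calc ∑ b, ‖δ x b‖ * ‖d b‖ * ‖T b y‖ ≤ ∑ b, η * (‖d b‖ * ‖T b y‖) := by
          refine sum_le_sum fun b _ => ?_
          rw [mul_assoc]
          exact mul_le_mul_of_nonneg_right (hη x b) (mul_nonneg (norm_nonneg _) (norm_nonneg _))
      _ = η * ∑ b, ‖d b‖ * ‖T b y‖ := by rw [mul_sum]
      _ ≤ η * τ := mul_le_mul_of_nonneg_left hτ hη0
  have h3 : ∑ a, ‖C' x a‖ * ‖d a‖ * ‖δ a y‖ ≤ ρ * η := by
    calc ∑ a, ‖C' x a‖ * ‖d a‖ * ‖δ a y‖ ≤ ∑ a, ‖C' x a‖ * ‖d a‖ * η :=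
          sum_le_sum fun a _ => mul_le_mul_of_nonneg_left (hη a y) (mul_nonneg (norm_nonneg _) (norm_nonneg _))
      _ = (∑ a, ‖C' x a‖ * ‖d a‖) * η := by rw [sum_mul]
      _ ≤ ρ * η := mul_le_mul_of_nonneg_right hρ hη0
  have h4 : ∑ a, ∑ b, ‖C' x a‖ * ‖d a‖ * ‖δ a b‖ * ‖d b‖ * ‖T b y‖ ≤ ρ * η * τ := by
    calc ∑ a, ∑ b, ‖C' x a‖ * ‖d a‖ * ‖δ a b‖ * ‖d b‖ * ‖T b y‖
        ≤ ∑ a, ∑ b, ‖C' x a‖ * ‖d a‖ * η * (‖d b‖ * ‖T b y‖) := by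
          refine sum_le_sum fun a _ => sum_le_sum fun b _ => ?_
          have : ‖C' x a‖ * ‖d a‖ * ‖δ a b‖ ≤ ‖C' x a‖ * ‖d a‖ * η :=
            mul_le_mul_of_nonneg_left (hη a b) (mul_nonneg (norm_nonneg _) (norm_nonneg _))
          calc ‖C' x a‖ * ‖d a‖ * ‖δ a b‖ * ‖d b‖ * ‖T b y‖ = (‖C' x a‖ * ‖d a‖ * ‖δ a b‖) * (‖d b‖ * ‖T b y‖) := by ring
            _ ≤ (‖C' x a‖ * ‖d a‖ * η) * (‖d b‖ * ‖T b y‖) :=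
                mul_le_mul_of_nonneg_right this (mul_nonneg (norm_nonneg _) (norm_nonneg _))
      _ = (∑ a, ‖C' x a‖ * ‖d a‖) * η * ∑ b, ‖d b‖ * ‖T b y‖ := by
          rw [sum_mul, sum_mul]
          refine sum_congr rfl fun a _ => ?_
          rw [mul_sum]
      _ ≤ ρ * η * τ := by
          have hA : (∑ a, ‖C' x a‖ * ‖d a‖) * η ≤ ρ * η := mul_le_mul_of_nonneg_right hρ hη0
          exact mul_le_mul hA hτ (sum_nonneg fun b _ => mul_nonneg (norm_nonneg _) (norm_nonneg _)) (mul_nonneg hρ0 hη0)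
  have : η * (1 + ρ) * (1 + τ) = η + η * τ + ρ * η + ρ * η * τ := by ring
  linarith

end Bounds

/-! ## §3 The one-slice Bethe–Salpeter form of (E2-v8) at `1 ≤ n` -/

section FourTerm

variable {S F : Type*} [Fintype S] [Fintype F]

/-- **Four-term collapse against ONE sup bound.**  On `S × F`, with `E(a,b) = J(a,b) − C(a.1,b.1)` bounded by `η` on every pair of
relevant-or-external indices (`rel a := z′_a ≠ 0 ∨ ext a`), `m·Σ‖z′‖ ≤ 1/3` and `m′·Σ‖z′‖ ≤ 1/3`: at an external entry `(x,y)` the four-term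
localisation expression is `≤ (9/4)·η` (`= η + η/2 + η/2 + η/4`). -/
theorem klli_fourTerm_le_of_sup (C : Matrix S S ℂ) (J : Matrix (S × F) (S × F) ℂ) (z' : S × F → ℂ) (ext : S × F → Prop) {m m' η : ℝ}
    (hm : 0 ≤ m) (hm' : 0 ≤ m') (hη : 0 ≤ η) (hzC : m * ∑ a, ‖z' a‖ ≤ 1 / 3) (hzK : m' * ∑ a, ‖z' a‖ ≤ 1 / 3)
    (hE : ∀ a b, (z' a ≠ 0 ∨ ext a) → (z' b ≠ 0 ∨ ext b) → ‖J a b - C a.1 b.1‖ ≤ η) (x y : S × F) (hx : ext x) (hy : ext y) :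
    ‖J x y - C x.1 y.1‖ + 3 / 2 * m * ∑ b, ‖J x b - C x.1 b.1‖ * ‖z' b‖ + 3 / 2 * m' * ∑ a, ‖z' a‖ * ‖J a y - C a.1 y.1‖ +
        9 / 4 * m' * m * ∑ a, ∑ b, ‖z' a‖ * ‖J a b - C a.1 b.1‖ * ‖z' b‖ ≤ 9 / 4 * η := by
  obtain ⟨Z, hZ_def⟩ : ∃ Z : ℝ, Z = ∑ a, ‖z' a‖ := ⟨_, rfl⟩
  have hZ : 0 ≤ Z := by rw [hZ_def]; exact sum_nonneg fun a _ => norm_nonneg _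
  rw [← hZ_def] at hzC hzK
  -- weighted entries: `‖E(a,b)‖·‖z′_b‖ ≤ η·‖z′_b‖` when `a` is relevant-or-external (if `z′_b = 0` both sides vanish)
  have hcol : ∀ a b, (z' a ≠ 0 ∨ ext a) → ‖J a b - C a.1 b.1‖ * ‖z' b‖ ≤ η * ‖z' b‖ := by
    intro a b ha
    by_cases hb : z' b = 0
    · simp [hb]
    · exact mul_le_mul_of_nonneg_right (hE a b ha (Or.inl hb)) (norm_nonneg _)
  have hrow : ∀ a b, (z' b ≠ 0 ∨ ext b) → ‖z' a‖ * ‖J a b - C a.1 b.1‖ ≤ ‖z' a‖ * η := by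
    intro a b hb
    by_cases ha : z' a = 0
    · simp [ha]
    · exact mul_le_mul_of_nonneg_left (hE a b (Or.inl ha) hb) (norm_nonneg _)
  have h1 : ‖J x y - C x.1 y.1‖ ≤ η := hE x y (Or.inr hx) (Or.inr hy)
  have h2 : ∑ b, ‖J x b - C x.1 b.1‖ * ‖z' b‖ ≤ η * Z := by
    calc ∑ b, ‖J x b - C x.1 b.1‖ * ‖z' b‖ ≤ ∑ b, η * ‖z' b‖ := sum_le_sum fun b _ => hcol x b (Or.inr hx)
      _ = η * Z := by rw [← mul_sum, hZ_def]
  have h3 : ∑ a, ‖z' a‖ * ‖J a y - C a.1 y.1‖ ≤ Z * η := by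
    calc ∑ a, ‖z' a‖ * ‖J a y - C a.1 y.1‖ ≤ ∑ a, ‖z' a‖ * η := sum_le_sum fun a _ => hrow a y (Or.inr hy)
      _ = Z * η := by rw [← sum_mul, hZ_def]
  have h4 : ∑ a, ∑ b, ‖z' a‖ * ‖J a b - C a.1 b.1‖ * ‖z' b‖ ≤ Z * η * Z := by
    calc ∑ a, ∑ b, ‖z' a‖ * ‖J a b - C a.1 b.1‖ * ‖z' b‖ ≤ ∑ a, ∑ b, ‖z' a‖ * (η * ‖z' b‖) := by
          refine sum_le_sum fun a _ => sum_le_sum fun b _ => ?_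
          by_cases ha : z' a = 0
          · simp [ha]
          · rw [mul_assoc]
            exact mul_le_mul_of_nonneg_left (hcol a b (Or.inl ha)) (norm_nonneg _)
      _ = ∑ a, ‖z' a‖ * (η * Z) := by
          refine sum_congr rfl fun a _ => ?_
          rw [← mul_sum, ← mul_sum, hZ_def]
      _ = Z * η * Z := by rw [← sum_mul, ← hZ_def]; ring
  -- smallness: `m·Z ≤ 1/3`, `m′·Z ≤ 1/3`
  have e2 : 3 / 2 * m * (η * Z) ≤ 1 / 2 * η := by
    have : m * (η * Z) = η * (m * Z) := by ring
    rw [mul_assoc, this]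
    nlinarith [mul_le_mul_of_nonneg_left hzC hη]
  have e3 : 3 / 2 * m' * (Z * η) ≤ 1 / 2 * η := by
    have : m' * (Z * η) = η * (m' * Z) := by ring
    rw [mul_assoc, this]
    nlinarith [mul_le_mul_of_nonneg_left hzK hη]
  have e4 : 9 / 4 * m' * m * (Z * η * Z) ≤ 1 / 4 * η := by
    have : 9 / 4 * m' * m * (Z * η * Z) = 9 / 4 * η * ((m' * Z) * (m * Z)) := by ring
    rw [this]
    have hprod : (m' * Z) * (m * Z) ≤ 1 / 3 * (1 / 3) :=
      mul_le_mul hzK hzC (mul_nonneg hm hZ) (by norm_num)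
    nlinarith
  have s2 : 3 / 2 * m * ∑ b, ‖J x b - C x.1 b.1‖ * ‖z' b‖ ≤ 1 / 2 * η :=
    (mul_le_mul_of_nonneg_left h2 (by positivity)).trans e2
  have s3 : 3 / 2 * m' * ∑ a, ‖z' a‖ * ‖J a y - C a.1 y.1‖ ≤ 1 / 2 * η :=
    (mul_le_mul_of_nonneg_left h3 (by positivity)).trans e3
  have s4 : 9 / 4 * m' * m * ∑ a, ∑ b, ‖z' a‖ * ‖J a b - C a.1 b.1‖ * ‖z' b‖ ≤ 1 / 4 * η :=
    (mul_le_mul_of_nonneg_left h4 (by positivity)).trans e4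
  linarith

end FourTerm

section Model

variable (L M : ℕ) [NeZero L] [NeZero M]
variable {F : Type*} [Fintype F] [DecidableEq F] [Nonempty F]

/-- **(E2-v8) at `1 ≤ n` in ONE-SLICE BETHE–SALPETER FORM.**  Fix the slice-frequency index type `F` and the external index `a₀ : F`.  Per
pair class `Qm` the engine supplies: the one-slice pair-irreducible rung `J` on `TorusSite 2 L × F` with `|J| ≤ m′` and `m′·Σ‖z′‖ ≤ 1/3`; the
FULL step-`n` rung weights `z′` (same-slice pair + both mixed pairs, frequency-resolved; `Σ‖z′‖ ≤ G.bhi`, the (neg) signed-mass input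
`≤ 2·klEdge G n |Qm|_𝕋`, the (real) input `Im Σ_b z′_(p,b) = 0`); a right inverse `N` of `1 + diag z′·J` together with the BETHE–SALPETER
IDENTITY `𝒞_n(Qm;k,k′) = (J·N)((k,a₀),(k′,a₀))` on the ball; and ONE number `η ≥ 0` with `‖J(a,b) − 𝒞̂_{n−1}(Qm;a.1,b.1)‖ ≤ η` for all index
pairs that are weighted or external, such that `(9/4)·η ≤ drivePBar + eremBar + thermalBar + legDressBarQ·countT` at every external pair.
Then `PairLadderStepAtV8 … n`.  (Proof: `K := J`, `T_K := J·N` in `pairLadderStepAtV8_of_expansion`; the ladder sum is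
`klcrs_single_slice_ladder_hasSum`; `‖𝒞_n − T_K‖ = 0`; the four-term expression is `≤ (9/4)η` by `klli_fourTerm_le_of_sup`.) -/
theorem pairLadderStepAtV8_of_sliceBS {G : GeoConsts} {P : SplitConsts} {Q : EngConsts} {β U μ : ℝ} {K₀ : TrigPolyC4v} {n : ℕ}
    (a₀ : F) (hn : 1 ≤ n)
    (hsplit : PairArrayAtV2 L M P Q β U μ K₀ (n - 1)) (hD : 0 ≤ P.C_W + klLegKappa * Q.CR * P.Klam ^ 3)
    (hsmall : G.bhi * (2 * |U| + (P.C_W + klLegKappa * Q.CR * P.Klam ^ 3) * U ^ 2) ≤ 1 / 3)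
    (hBS : ∀ Qm : TorusSite 2 L, IsPairClassAt L Qm n →
      ∃ (J : Matrix (TorusSite 2 L × F) (TorusSite 2 L × F) ℂ) (z' : TorusSite 2 L × F → ℂ)
        (N : Matrix (TorusSite 2 L × F) (TorusSite 2 L × F) ℂ) (m' η : ℝ),
        0 ≤ m' ∧ (∀ x y, ‖J x y‖ ≤ m') ∧ m' * ∑ x, ‖z' x‖ ≤ 1 / 3 ∧ ∑ x, ‖z' x‖ ≤ G.bhi ∧
        (∑ p, ‖∑ b, z' (p, b)‖) - (∑ p, ∑ b, z' (p, b)).re ≤ 2 * klEdge G n (klTorusNorm L Qm) ∧ (∀ p, (∑ b, z' (p, b)).im = 0) ∧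
        (1 + Matrix.diagonal z' * J) * N = 1 ∧
        (∀ k ∈ klBall L μ K₀, ∀ k' ∈ klBall L μ K₀, klPairAmplitude L M β U μ K₀ n Qm k k' = (J * N) (k, a₀) (k', a₀)) ∧
        0 ≤ η ∧
        (∀ a b : TorusSite 2 L × F, (z' a ≠ 0 ∨ (a.1 ∈ klBall L μ K₀ ∧ a.2 = a₀)) → (z' b ≠ 0 ∨ (b.1 ∈ klBall L μ K₀ ∧ b.2 = a₀)) →
          ‖J a b - klPairArray L M β U μ K₀ (n - 1) Qm a.1 b.1‖ ≤ η) ∧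
        ∀ k ∈ klBall L μ K₀, ∀ k' ∈ klBall L μ K₀,
          9 / 4 * η ≤ drivePBar G P U (n - 1) + eremBar G P Q U β L (n - 1) + thermalBar G P U β n +
            legDressBarQ G P Q U n (legSliceCountT L β μ K₀ n ![k', Qm - k', Qm - k, k])) :
    PairLadderStepAtV8 L M G P Q β U μ K₀ n := by
  have hm : 0 ≤ 2 * |U| + (P.C_W + klLegKappa * Q.CR * P.Klam ^ 3) * U ^ 2 := by
    have : 0 ≤ (P.C_W + klLegKappa * Q.CR * P.Klam ^ 3) * U ^ 2 := mul_nonneg hD (sq_nonneg U)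
    have : 0 ≤ |U| := abs_nonneg U
    linarith
  refine pairLadderStepAtV8_of_expansion L M a₀ hn hsplit hD hsmall fun Qm hQm => ?_
  obtain ⟨J, z', N, m', η, hm', hJ, hzK, hzsum, hmass, hreal, hN, hbs, hη, hE, hbud⟩ := hBS Qm hQm
  -- the ladder sum of `J` is `J·N`
  have hT := (klcrs_single_slice_ladder_hasSum z' hm' J hJ hzK N hN).2
  refine ⟨J, z', J * N, m', hm', hJ, hzK, hzsum, hmass, hreal, hT, fun k hk k' hk' => ?_⟩
  have hzC : (2 * |U| + (P.C_W + klLegKappa * Q.CR * P.Klam ^ 3) * U ^ 2) * ∑ x, ‖z' x‖ ≤ 1 / 3 :=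
    calc (2 * |U| + (P.C_W + klLegKappa * Q.CR * P.Klam ^ 3) * U ^ 2) * ∑ x, ‖z' x‖
        ≤ (2 * |U| + (P.C_W + klLegKappa * Q.CR * P.Klam ^ 3) * U ^ 2) * G.bhi := mul_le_mul_of_nonneg_left hzsum hm
      _ = G.bhi * (2 * |U| + (P.C_W + klLegKappa * Q.CR * P.Klam ^ 3) * U ^ 2) := mul_comm _ _
      _ ≤ 1 / 3 := hsmall
  have h0 : ‖klPairAmplitude L M β U μ K₀ n Qm k k' - (J * N) (k, a₀) (k', a₀)‖ = 0 := by
    rw [hbs k hk k' hk', sub_self, norm_zero]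
  have h4 := klli_fourTerm_le_of_sup (klPairArray L M β U μ K₀ (n - 1) Qm) J z' (fun a => a.1 ∈ klBall L μ K₀ ∧ a.2 = a₀)
    hm hm' hη hzC hzK hE (k, a₀) (k', a₀) ⟨hk, rfl⟩ ⟨hk', rfl⟩
  have hb := hbud k hk k' hk'
  rw [h0, zero_add]
  exact h4.trans hb

end Model

end Summit.HubbardSuperconductivity.HubbardSuperconductivity.Theorems.KLRegimeSplit

end
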